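import Summits.HodgeConjecture.HodgeConjecture.Theorems.F0P3cDyRamFourFrameUnipotentLabelDefs   -- ★ DEFS LEAF №6 (p854734): `unipotentLabel`, `NormClassPlus` (over ★ №3)
import Summits.HodgeConjecture.HodgeConjecture.Theorems.F0P3cDyRamWMatrixConj                   -- ★ (LH4-p03): `wMatrix` multiplicative; `X = 0` ∕ `X² = 0` descend along classes; support exclusions
import Literature.NumberTheory.Automorphic.OrbitalIntegralIndicatorSeparation                    -- ★ `classOrbitalIntegral_indicator_eq_zero_of_forall_not_mem`
import HarnessLib

/-!
# Crux `H413`, line LH4 «(D-RAM) FOUR-FRAME», tier 2 under `U4_Rows` §2: the EASY ZERO ENTRIES of the unipotent table — every entry `(u, gselStar j)` with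
# `unipotentLabel u < j` vanishes EXCEPT possibly `(label 1, j = 2)` = (class-`+` transvections, `f_{T−}`), which is the one label-theoretic entry (next file)

Cell `hodgecm-mathlib` (D-0151), FLOOR 0, crux item H413 = `stmt-HodgeConjecture-24833`, route of record `HCCMUnconditional`; squad F0∕P3c∕LH4, Track A; dealer LH4-plan
(g10) WORD #17 U4 cand v1 b2ef357bfcbb4be0 §2 `stub_U4_table_vanishing : … ∀ u : ↥S, ∀ j : Fin 4, unipotentLabel L w hw ϖ u < j → classOrbitalIntegral mU ((gselStar j) L v w hw ϖ) u = 0`;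
tier-2 hand LH4-p03 (g11).  THEOREMS ONLY (no `def`, no instance, no notation, no `sorry`, default heartbeats); lane `--supports stmt-HodgeConjecture-24833 --as helper`.

WHAT IS PROVED.  For a conjugacy class `u` of `G_v = U(Φ₃)(L⁺_v)` with representative matrix `X := wMatrix (Quotient.out u) − 1` (★ №6's reading) and ANY orbital-measure
family `mU` (no admissibility, no Rao clause needed — vanishing is support-theoretic, ★ `classOrbitalIntegral_indicator_eq_zero_of_forall_not_mem`):
* `label_eq_zero_iff` ∕ `sq_eq_zero_of_label_ne_three`: ★ №6 `unipotentLabel u = 0 ↔ X = 0`; `unipotentLabel u ≠ 3 → X·X = 0` (the `if`-cascade read back);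
* `orbital_transvPlus_eq_zero_of_label_eq_zero`, `orbital_transvMinus_eq_zero_of_label_eq_zero` — `X = 0` on the whole class (★ `wMatrix_sub_one_eq_zero_of_mk_eq`) ⇒ no
  class member is on a shell ⇒ `O_u(f_{T+}) = O_u(f_{T−}) = 0`;
* `orbital_reg_eq_zero_of_label_ne_three` — `X² = 0` on the whole class ⇒ `O_u(f_reg) = 0`;
* **`table_vanishing_easy`**: `unipotentLabel u < j → (j ≠ 2 ∨ unipotentLabel u = 0) → classOrbitalIntegral mU ((gselStar j) L v w hw ϖ) u = 0` — i.e. ALL entries of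
  `stub_U4_table_vanishing` except `(label u = 1, j = 2)`, whose content is «on `K ∩` shell, `NormClassPlus ⇒ LabelPlus`» + the `U(Φ₃)`-invariance of `NormClassPlus`
  (the M-step, next file); the stub's payer is then `table_vanishing_easy` ∪ that entry.

HONEST LABEL.  Count-neutral helper; the stub is NOT paid here.  (D-RAM) verdict of record PRINT [LanglandsShelstad1989 Thm. p. 484 ∕ Rogawski1990 Prop. 4.9.1 (a)] ∕ XL;
`HC_CM` is proved only modulo the 7 printed citations (2 remaining: hLiu418 = `stmt-HodgeConjecture-24832`, h413 = `stmt-HodgeConjecture-24833`) until rung 0 closes.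
-/

noncomputable section

namespace Summit.HodgeConjecture.HodgeConjecture.Cruxes.H413.F0P3cDyRamTableVanishingEasy

open MeasureTheory Measure NumberField IsDedekindDomain Topology Filter
open Literature.NumberTheory.Automorphic Literature.NumberTheory.Automorphic.UnitaryGroup Literature.NumberTheory.Automorphic.IntegralReduction
open Literature.NumberTheory.Rogawski1990 Literature.NumberTheory.GaloisRepresentations
open Summit.HodgeConjecture.HodgeConjecture.Cruxes.H413.F0P3cDyRamFourFramePieces
open Summit.HodgeConjecture.HodgeConjecture.Cruxes.H413.F0P3cDyRamFourFrameUnipotentLabelDefs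
open Summit.HodgeConjecture.HodgeConjecture.Cruxes.H413.F0P3cDyRamWMatrixConj
open scoped Matrix MatrixGroups Classical ValuativeRel

variable (L : Type) [Field L] [NumberField L] [IsCMField L] {v : HeightOneSpectrum (𝓞 ↥(maximalRealSubfield L))}
  (w : UnitaryGroup.PlacesOver L v) (hw : IsCMField.complexConj L • w.1 = w.1) (ϖ : w.1.adicCompletion L)

/-! ## §1  Reading ★ №6 `unipotentLabel` back -/

/-- `unipotentLabel u = 0 ↔ wMatrix (out u) − 1 = 0`. -/
theorem label_eq_zero_iff (u : ConjClasses ((UnitaryGroup.cmDatum L 3 (Matrix.of fun i j : Fin 3 => if i.val + j.val + 1 = 3 then (1 : L) else 0)).Local v)) :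
    unipotentLabel L w hw ϖ u = 0 ↔ wMatrix L w hw (Quotient.out u) - 1 = 0 := by
  unfold unipotentLabel
  split_ifs with h0 h1 h2
  · exact ⟨fun _ => h0, fun _ => rfl⟩
  · exact ⟨fun h => absurd h (by decide), fun h => absurd h h0⟩
  · exact ⟨fun h => absurd h (by decide), fun h => absurd h h0⟩
  · exact ⟨fun h => absurd h (by decide), fun h => absurd h h0⟩

/-- `unipotentLabel u ≠ 3 → (wMatrix (out u) − 1)² = 0`. -/
theorem sq_eq_zero_of_label_ne_three (u : ConjClasses ((UnitaryGroup.cmDatum L 3 (Matrix.of fun i j : Fin 3 => if i.val + j.val + 1 = 3 then (1 : L) else 0)).Local v))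
    (h3 : unipotentLabel L w hw ϖ u ≠ 3) :
    (wMatrix L w hw (Quotient.out u) - 1) * (wMatrix L w hw (Quotient.out u) - 1) = 0 := by
  unfold unipotentLabel at h3
  split_ifs at h3 with h0 h1
  · rw [h0, Matrix.zero_mul]
  · exact h1
  · exact h1
  · exact absurd rfl h3

/-! ## §2  The support-theoretic zero entries -/

/-- `ConjClasses.mk g = u ⇒ ConjClasses.mk g = ConjClasses.mk (Quotient.out u)`. -/
theorem mk_eq_mk_out {G : Type*} [Monoid G] {u : ConjClasses G} {g : G} (hg : ConjClasses.mk g = u) :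
    ConjClasses.mk g = ConjClasses.mk (Quotient.out u) := by
  rw [hg, ← ConjClasses.quotient_mk_eq_mk, Quotient.out_eq]

/-- **`label u = 0 ⇒ O_u(f_{T+}) = 0`** (no class member is on a shell). -/
theorem orbital_transvPlus_eq_zero_of_label_eq_zero
    [MeasurableSpace ((UnitaryGroup.cmDatum L 3 (Matrix.of fun i j : Fin 3 => if i.val + j.val + 1 = 3 then (1 : L) else 0)).Local v)]
    [∀ γ : ((UnitaryGroup.cmDatum L 3 (Matrix.of fun i j : Fin 3 => if i.val + j.val + 1 = 3 then (1 : L) else 0)).Local v), MeasurableSpace (((UnitaryGroup.cmDatum L 3 (Matrix.of fun i j : Fin 3 => if i.val + j.val + 1 = 3 then (1 : L) else 0)).Local v) ⧸ Subgroup.centralizer ({γ} : Set ((UnitaryGroup.cmDatum L 3 (Matrix.of fun i j : Fin 3 => if i.val + j.val + 1 = 3 then (1 : L) else 0)).Local v)))]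
    (mU : OrbitalMeasureFamily ((UnitaryGroup.cmDatum L 3 (Matrix.of fun i j : Fin 3 => if i.val + j.val + 1 = 3 then (1 : L) else 0)).Local v))
    (u : ConjClasses ((UnitaryGroup.cmDatum L 3 (Matrix.of fun i j : Fin 3 => if i.val + j.val + 1 = 3 then (1 : L) else 0)).Local v)) (h0 : unipotentLabel L w hw ϖ u = 0) :
    classOrbitalIntegral mU (pieceTransvPlus L v w hw ϖ) u = 0 := by
  rw [label_eq_zero_iff] at h0
  unfold pieceTransvPlus
  exact classOrbitalIntegral_indicator_eq_zero_of_forall_not_mem mU _ u fun g hg =>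
    not_mem_supportTransvPlus_of_sub_one_eq_zero L w hw ϖ (wMatrix_sub_one_eq_zero_of_mk_eq L w hw (mk_eq_mk_out hg) h0)

/-- **`label u = 0 ⇒ O_u(f_{T−}) = 0`**. -/
theorem orbital_transvMinus_eq_zero_of_label_eq_zero
    [MeasurableSpace ((UnitaryGroup.cmDatum L 3 (Matrix.of fun i j : Fin 3 => if i.val + j.val + 1 = 3 then (1 : L) else 0)).Local v)]
    [∀ γ : ((UnitaryGroup.cmDatum L 3 (Matrix.of fun i j : Fin 3 => if i.val + j.val + 1 = 3 then (1 : L) else 0)).Local v), MeasurableSpace (((UnitaryGroup.cmDatum L 3 (Matrix.of fun i j : Fin 3 => if i.val + j.val + 1 = 3 then (1 : L) else 0)).Local v) ⧸ Subgroup.centralizer ({γ} : Set ((UnitaryGroup.cmDatum L 3 (Matrix.of fun i j : Fin 3 => if i.val + j.val + 1 = 3 then (1 : L) else 0)).Local v)))]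
    (mU : OrbitalMeasureFamily ((UnitaryGroup.cmDatum L 3 (Matrix.of fun i j : Fin 3 => if i.val + j.val + 1 = 3 then (1 : L) else 0)).Local v))
    (u : ConjClasses ((UnitaryGroup.cmDatum L 3 (Matrix.of fun i j : Fin 3 => if i.val + j.val + 1 = 3 then (1 : L) else 0)).Local v)) (h0 : unipotentLabel L w hw ϖ u = 0) :
    classOrbitalIntegral mU (pieceTransvMinus L v w hw ϖ) u = 0 := by
  rw [label_eq_zero_iff] at h0
  unfold pieceTransvMinus
  exact classOrbitalIntegral_indicator_eq_zero_of_forall_not_mem mU _ u fun g hg =>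
    not_mem_supportTransvMinus_of_sub_one_eq_zero L w hw ϖ (wMatrix_sub_one_eq_zero_of_mk_eq L w hw (mk_eq_mk_out hg) h0)

/-- **`label u ≠ 3 ⇒ O_u(f_reg) = 0`** (`X² = 0` on the whole class: the identity and both transvection classes miss `f_reg`). -/
theorem orbital_reg_eq_zero_of_label_ne_three
    [MeasurableSpace ((UnitaryGroup.cmDatum L 3 (Matrix.of fun i j : Fin 3 => if i.val + j.val + 1 = 3 then (1 : L) else 0)).Local v)]
    [∀ γ : ((UnitaryGroup.cmDatum L 3 (Matrix.of fun i j : Fin 3 => if i.val + j.val + 1 = 3 then (1 : L) else 0)).Local v), MeasurableSpace (((UnitaryGroup.cmDatum L 3 (Matrix.of fun i j : Fin 3 => if i.val + j.val + 1 = 3 then (1 : L) else 0)).Local v) ⧸ Subgroup.centralizer ({γ} : Set ((UnitaryGroup.cmDatum L 3 (Matrix.of fun i j : Fin 3 => if i.val + j.val + 1 = 3 then (1 : L) else 0)).Local v)))]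
    (mU : OrbitalMeasureFamily ((UnitaryGroup.cmDatum L 3 (Matrix.of fun i j : Fin 3 => if i.val + j.val + 1 = 3 then (1 : L) else 0)).Local v))
    (u : ConjClasses ((UnitaryGroup.cmDatum L 3 (Matrix.of fun i j : Fin 3 => if i.val + j.val + 1 = 3 then (1 : L) else 0)).Local v)) (h3 : unipotentLabel L w hw ϖ u ≠ 3) :
    classOrbitalIntegral mU (pieceReg L v w hw ϖ) u = 0 := by
  have hsq := sq_eq_zero_of_label_ne_three L w hw ϖ u h3
  unfold pieceReg
  exact classOrbitalIntegral_indicator_eq_zero_of_forall_not_mem mU _ u fun g hg =>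
    not_mem_supportReg_of_sub_one_sq_eq_zero L w hw ϖ (wMatrix_sub_one_sq_eq_zero_of_mk_eq L w hw (mk_eq_mk_out hg) hsq)

/-- **THE EASY ZERO ENTRIES OF THE TABLE**: `unipotentLabel u < j` and `(j ≠ 2 ∨ unipotentLabel u = 0)` ⇒ `classOrbitalIntegral mU ((gselStar j) L v w hw ϖ) u = 0` —
every entry of `stub_U4_table_vanishing` except `(label 1, j = 2)`. -/
theorem table_vanishing_easy
    [MeasurableSpace ((UnitaryGroup.cmDatum L 3 (Matrix.of fun i j : Fin 3 => if i.val + j.val + 1 = 3 then (1 : L) else 0)).Local v)]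
    [∀ γ : ((UnitaryGroup.cmDatum L 3 (Matrix.of fun i j : Fin 3 => if i.val + j.val + 1 = 3 then (1 : L) else 0)).Local v), MeasurableSpace (((UnitaryGroup.cmDatum L 3 (Matrix.of fun i j : Fin 3 => if i.val + j.val + 1 = 3 then (1 : L) else 0)).Local v) ⧸ Subgroup.centralizer ({γ} : Set ((UnitaryGroup.cmDatum L 3 (Matrix.of fun i j : Fin 3 => if i.val + j.val + 1 = 3 then (1 : L) else 0)).Local v)))]
    (mU : OrbitalMeasureFamily ((UnitaryGroup.cmDatum L 3 (Matrix.of fun i j : Fin 3 => if i.val + j.val + 1 = 3 then (1 : L) else 0)).Local v))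
    (u : ConjClasses ((UnitaryGroup.cmDatum L 3 (Matrix.of fun i j : Fin 3 => if i.val + j.val + 1 = 3 then (1 : L) else 0)).Local v)) (j : Fin 4)
    (hlt : unipotentLabel L w hw ϖ u < j) (heasy : j ≠ 2 ∨ unipotentLabel L w hw ϖ u = 0) :
    classOrbitalIntegral mU ((gselStar j) L v w hw ϖ) u = 0 := by
  have hjlt := j.isLt
  have hlt' : (unipotentLabel L w hw ϖ u).val < j.val := Fin.lt_def.1 hlt
  have hne3 : unipotentLabel L w hw ϖ u ≠ 3 := fun h => by
    have h3 := congrArg Fin.val h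
    change _ = 3 at h3
    omega
  fin_cases j
  · change _ < 0 at hlt'
    omega
  · have h0 : unipotentLabel L w hw ϖ u = 0 := by
      rcases heasy with _ | h
      · change _ < 1 at hlt'
        refine Fin.ext ?_
        change _ = 0
        omega
      · exact h
    exact orbital_transvPlus_eq_zero_of_label_eq_zero L w hw ϖ mU u h0
  · rcases heasy with h | h
    · exact absurd rfl h
    · exact orbital_transvMinus_eq_zero_of_label_eq_zero L w hw ϖ mU u h
  · exact orbital_reg_eq_zero_of_label_ne_three L w hw ϖ mU u hne3

end Summit.HodgeConjecture.HodgeConjecture.Cruxes.H413.F0P3cDyRamTableVanishingEasy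

end
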